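import Mathlib
import HarnessLib
import Literature.Analysis.FluidPDE.NSBoundedHigherRegularityQuantProofs
import Literature.Analysis.FluidPDE.NSLocalLerayFarFieldRegularSlabProofs
import Literature.Analysis.FluidPDE.ClassicalSolutionRescale
import Literature.Analysis.FluidPDE.VorticityStretching
import Literature.Analysis.FluidPDE.SpaceTimeCalculus
import Literature.Analysis.FluidPDE.TaoEnstrophyLocalisation
import Summits.NavierStokesRegularity.NavierStokesRegularity.Theorems.LocalIrrotationalScarDoorZoomDataTop
import Summits.NavierStokesRegularity.NavierStokesRegularity.Theorems.LocalSineTubeDoorLocalPointZoomGradSlices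

/-!
# STAGED door S15 `LocalIrrotationalScarDoor` (nsreg-p1 ROUND-14), zoom crux `K1Rep` (`LocalPointZoomScarCurlRep`) —
# support tools, part 4: UNIFORM `C³` BOUNDS of the zooms on top cylinders away from the axis, and the resulting
# uniform bound of the TIME DERIVATIVE OF THEIR VORTICITY

Step (iii-b) of the `K1Rep` plan (ROUND-14 §4 Day 2).  Inputs of `…ZoomDataTop.localZoomFrame_data_top` (distributional
equations, apex sup bound, pressure mass on `Q((0,x), r₀)`, uniformly in `j`) fed into the tree's quantitative local
regularity `NSBoundedHigherRegularityBounds_holds` (Seregin–Šverák 2009 §2):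

* `zoom_top_uniform_bounds` — eventually in `j`, on the inner top cylinder `Q((0,x), r₀/2)`:
  `‖Dⁿ Zⱼ(s,·)(y)‖ ≤ K` for `n ≤ 3`, ONE `K` for all `j` (the smooth representative of
  `NSBoundedHigherRegularityBounds_holds.exists_uniform_bound` coincides with the continuous zoom on the open cylinder);
* `zoom_top_curl_hasDerivAt_bound` — consequently the zooms, classical solutions of the unit-viscosity system
  (`IsClassicalNSSolutionOn.stRescale` of `u`), satisfy `|∂ₛ curl Zⱼ(s, y)| ≤ 3κK + 2κK²` there (`κ = ‖curlCLM‖`;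
  vorticity equation `curl_timeDerivWithin_eq` + `vorticity_pointwise_bounds`).

Seat nsreg-p6 g7; helper toward the S15 zoom crux (anchor `--supports stmt-NavierStokesRegularity-11719`).
WHAT THIS IS NOT: not NS regularity; not `K1Rep` (the fading needs, in addition, the top trace — part 5).
-/

noncomputable section

open MeasureTheory Set Function Filter Topology TopologicalSpace Metric
open Literature.Analysis Literature.Analysis.FluidPDE Literature.Analysis.FluidPDE.SereginSverak2009
open Summit.NavierStokesRegularity.NavierStokesRegularity.Theorems
open Summit.NavierStokesRegularity.NavierStokesRegularity.Theorems.LocalIrrotationalScarDoorZoomApex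
open Summit.NavierStokesRegularity.NavierStokesRegularity.Theorems.LocalIrrotationalScarDoorZoomDataTop
open Summit.NavierStokesRegularity.NavierStokesRegularity.Theorems.LocalSineTubeDoorLocalPointZoomGradSlices
open scoped NNReal ENNReal

-- the summit and its single sub-problem share the name (CONVENTIONS §1), as in every Theorems file
set_option linter.dupNamespace false

namespace Summit.NavierStokesRegularity.NavierStokesRegularity.Theorems.LocalIrrotationalScarDoorZoomTopRegularity

variable {ν T : ℝ} {u : ℝ → EuclideanSpace ℝ (Fin 3) → EuclideanSpace ℝ (Fin 3)}
  {p : ℝ → EuclideanSpace ℝ (Fin 3) → ℝ} {x₀ : EuclideanSpace ℝ (Fin 3)} {ρ M R : ℝ}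
  {v' : ℝ → EuclideanSpace ℝ (Fin 3) → EuclideanSpace ℝ (Fin 3)} {π' : ℝ → EuclideanSpace ℝ (Fin 3) → ℝ}
  {lam : ℕ → ℝ} {Ks : ℝ≥0} {r₁ : ℝ} {x : EuclideanSpace ℝ (Fin 3)} {r₀ : ℝ}

set_option maxHeartbeats 400000 in
/-- **Uniform `C³` bounds of the zooms on the inner top cylinder `Q((0,x), r₀/2)`** (`0 < r₀ ≤ ‖x‖/2`), eventually
in `j`, with one constant for all `j`. -/
theorem zoom_top_uniform_bounds (hν : 0 < ν) (hT : 0 < T) (hsol : IsClassicalNSSolutionOn (Ico 0 T) ν 0 u p)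
    (hρ : 0 < ρ)
    (hM : ∀ t ∈ Ico 0 T, T - ρ ^ 2 < t → ∀ x ∈ ball x₀ ρ,
      ‖u t x‖ * (‖x - x₀‖ + Real.sqrt (ν * (T - t))) ≤ M)
    (hR : 0 < R) (hball1 : IsSuitableWeakSolutionInBall 1 0 v' π') (hlam : ∀ j, 0 < lam j)
    (hlam0 : Tendsto lam atTop (𝓝 0)) (hr₁ : 0 < r₁) (hr₁1 : r₁ ≤ 1)
    (hKs : ∀ r ∈ Ioc (0 : ℝ) r₁, cknD r (0 : ℝ × EuclideanSpace ℝ (Fin 3)) π' ≤ Ks)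
    (hpt : ∀ (j : ℕ) (s : ℝ) (y : EuclideanSpace ℝ (Fin 3)),
      ((lam j) • stPull ((lam j) ^ 2) (lam j) (0 : ℝ) (0 : EuclideanSpace ℝ (Fin 3)) v') s y =
        ((R * (lam j / 2)) / ν) • u (T + (R * (lam j / 2)) ^ 2 * s / ν) (x₀ + (R * (lam j / 2)) • y))
    (hr₀ : 0 < r₀) (hr₀x : r₀ ≤ ‖x‖ / 2) :
    ∃ (J : ℕ) (K : ℝ), 0 ≤ K ∧ ∀ j, J ≤ j →
      ∀ w ∈ parabolicCylinder (r₀ / 2) (((0 : ℝ), x) : ℝ × EuclideanSpace ℝ (Fin 3)), ∀ n ≤ 3,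
        ‖iteratedFDeriv ℝ n (((lam j) • stPull ((lam j) ^ 2) (lam j) (0 : ℝ) (0 : EuclideanSpace ℝ (Fin 3)) v') w.1)
          w.2‖ ≤ K := by
  have hΛpos : ∀ j, 0 < (R * (lam j / 2)) := fun j => mul_pos hR (half_pos (hlam j))
  have hΛ0 : Tendsto (fun j => (R * (lam j / 2))) atTop (𝓝 0) := by
    simpa using (hlam0.div_const 2).const_mul R
  obtain ⟨J₀, hJ₀⟩ := localZoomFrame_data_top hν hT hρ hM hR hball1 hlam hlam0 hr₁ hr₁1 hKs hpt hr₀ hr₀x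
  -- the zoomed times of the top cylinder lie in `[0, T)` (continuity of the zooms)
  set a : ℝ := 2 * ‖x‖ + 2 with ha_def
  have ha : 0 < a := by positivity
  have hQa : parabolicCylinder r₀ (((0 : ℝ), x) : ℝ × EuclideanSpace ℝ (Fin 3)) ⊆
      parabolicCylinder a (0 : ℝ × EuclideanSpace ℝ (Fin 3)) := by
    intro w hw
    rw [mem_parabolicCylinder_top_iff] at hw
    obtain ⟨⟨h1, h2⟩, h3⟩ := hw
    rw [SuitableCompactness.mem_parabolicCylinder_zero]
    have hr2 : r₀ ^ 2 < a ^ 2 := by nlinarith [norm_nonneg x]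
    refine ⟨⟨by linarith, h2⟩, ?_⟩
    calc ‖w.2‖ ≤ dist w.2 x + ‖x‖ := by simpa [dist_zero_right] using dist_triangle w.2 x 0
      _ < a := by rw [ha_def]; linarith [norm_nonneg x]
  obtain ⟨J₁, hJ₁⟩ := eventually_atTop.1 (eventually_zoom_region (x₀ := x₀) hν hT hρ hΛpos hΛ0 ha)
  -- the quantitative local regularity, with one constant
  have hr : r₀ / 2 ∈ Ioo 0 r₀ := ⟨by positivity, by linarith⟩
  obtain ⟨K₀, hK₀⟩ := NSBoundedHigherRegularityBounds_holds.exists_uniform_bound r₀ ((M / ν) / r₀)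
    (((2 * ‖x‖ + 2) ^ 2).toNNReal * Ks) hr 3
  have hK₀nn : 0 ≤ K₀ := by
    -- `K₀ ≥ 0`: the bound holds at some point of the (nonempty) inner cylinder for `n = 0`
    obtain ⟨hdist, hbd, hP⟩ := hJ₀ (max J₀ J₁) (le_max_left _ _)
    obtain ⟨V, -, -, -, -, hVb⟩ := hK₀ _ _ _ hdist hbd hP
    have hw : (((-(r₀ / 2) ^ 2 / 2 : ℝ)), x) ∈
        parabolicCylinder (r₀ / 2) (((0 : ℝ), x) : ℝ × EuclideanSpace ℝ (Fin 3)) := by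
      rw [mem_parabolicCylinder_top_iff]
      refine ⟨⟨by nlinarith [pow_pos hr₀ 2], by
        have := pow_pos (half_pos hr₀) 2; simp only; linarith⟩, by simp [half_pos hr₀]⟩
    exact (norm_nonneg _).trans (hVb 0 (by norm_num) _ hw)
  refine ⟨max J₀ J₁, K₀, hK₀nn, fun j hj w hw n hn => ?_⟩
  have hj₀ : J₀ ≤ j := (le_max_left _ _).trans hj
  have hj₁ : J₁ ≤ j := (le_max_right _ _).trans hj
  obtain ⟨hdist, hbd, hP⟩ := hJ₀ j hj₀
  obtain ⟨V, hae, hVc, -, -, hVb⟩ := hK₀ _ _ _ hdist hbd hP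
  -- the zoom is continuous on the cylinder
  set Z : ℝ → EuclideanSpace ℝ (Fin 3) → EuclideanSpace ℝ (Fin 3) :=
    (lam j) • stPull ((lam j) ^ 2) (lam j) (0 : ℝ) (0 : EuclideanSpace ℝ (Fin 3)) v' with hZ
  have hZcont : ContinuousOn (uncurry Z) (parabolicCylinder r₀ (((0 : ℝ), x) : ℝ × EuclideanSpace ℝ (Fin 3))) := by
    have hφ : Continuous fun w : ℝ × EuclideanSpace ℝ (Fin 3) =>
        (T + (R * (lam j / 2)) ^ 2 * w.1 / ν, x₀ + (R * (lam j / 2)) • w.2) := by fun_prop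
    have hmaps : MapsTo (fun w : ℝ × EuclideanSpace ℝ (Fin 3) =>
        (T + (R * (lam j / 2)) ^ 2 * w.1 / ν, x₀ + (R * (lam j / 2)) • w.2))
        (parabolicCylinder r₀ (((0 : ℝ), x) : ℝ × EuclideanSpace ℝ (Fin 3))) (Ico 0 T ×ˢ univ) := by
      intro w hw
      exact mem_prod.2 ⟨(hJ₁ j hj₁ w (hQa hw)).1, mem_univ _⟩
    have hc := (hsol.smooth_velocity.continuousOn.comp hφ.continuousOn hmaps).const_smul
      ((R * (lam j / 2)) / ν)
    refine hc.congr fun w _ => ?_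
    exact hpt j w.1 w.2
  have hEq : EqOn (uncurry Z) (uncurry V) (parabolicCylinder r₀ (((0 : ℝ), x) : ℝ × EuclideanSpace ℝ (Fin 3))) :=
    Measure.eqOn_open_of_ae_eq hae (isOpen_parabolicCylinder _ _) hZcont hVc
  -- slices agree near `w.2`, hence so do their derivatives
  have hwQ : w ∈ parabolicCylinder r₀ (((0 : ℝ), x) : ℝ × EuclideanSpace ℝ (Fin 3)) := by
    rw [mem_parabolicCylinder_top_iff] at hw ⊢
    obtain ⟨⟨h1, h2⟩, h3⟩ := hw
    exact ⟨⟨by nlinarith [pow_pos hr₀ 2], h2⟩, by linarith⟩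
  have hslice : Z w.1 =ᶠ[𝓝 w.2] V w.1 := by
    rw [mem_parabolicCylinder_top_iff] at hwQ
    have hball : ball x r₀ ∈ 𝓝 w.2 := isOpen_ball.mem_nhds (mem_ball.2 hwQ.2)
    filter_upwards [hball] with y hy
    have hmem : (w.1, y) ∈ parabolicCylinder r₀ (((0 : ℝ), x) : ℝ × EuclideanSpace ℝ (Fin 3)) := by
      rw [mem_parabolicCylinder_top_iff]; exact ⟨hwQ.1, mem_ball.1 hy⟩
    exact hEq hmem
  rw [(hslice.iteratedFDeriv (𝕜 := ℝ) n).eq_of_nhds]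
  exact hVb n hn w hw


/-- The curl of a rescaled slice: `curl((c • stPull β γ t₀ x₀ u) s)(y) = (cγ) curl(u(t₀ + βs))(x₀ + γy)`. -/
theorem curl_smul_stPull (c β γ t₀ : ℝ) (x₁ : EuclideanSpace ℝ (Fin 3))
    (f : ℝ → EuclideanSpace ℝ (Fin 3) → EuclideanSpace ℝ (Fin 3)) (s : ℝ) (y : EuclideanSpace ℝ (Fin 3)) :
    curl ((c • stPull β γ t₀ x₁ f) s) y = (c * γ) • curl (f (t₀ + β * s)) (x₁ + γ • y) := by
  rw [curl_eq_curlCLM, fderiv_smul_stPull, map_smul, ← curl_eq_curlCLM]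

set_option maxHeartbeats 400000 in
/-- **Uniform bound of the time derivative of the zoomed vorticity on the inner top cylinder.**  In the setting of
`zoom_top_uniform_bounds` (with `u` a classical solution on `[0,T)`), the zooms
`Zⱼ = (μⱼ/ν)•u(T + μⱼ²·/ν, x₀ + μⱼ·)`, `μⱼ = Rλⱼ/2`, are classical solutions of the unit-viscosity system for
`s < 0` near the top, and for `j` large and `(s,y) ∈ Q((0,x), r₀/2)` the time line `σ ↦ curl Zⱼ(σ)(y)` has a
derivative at `s` of norm `≤ 3κK + 2κK²`, `κ = ‖curlCLM‖`, `K` the constant of `zoom_top_uniform_bounds`. -/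
theorem zoom_top_curl_hasDerivAt_bound (hν : 0 < ν) (hT : 0 < T) (hsol : IsClassicalNSSolutionOn (Ico 0 T) ν 0 u p)
    (hρ : 0 < ρ)
    (hM : ∀ t ∈ Ico 0 T, T - ρ ^ 2 < t → ∀ x ∈ ball x₀ ρ,
      ‖u t x‖ * (‖x - x₀‖ + Real.sqrt (ν * (T - t))) ≤ M)
    (hR : 0 < R) (hball1 : IsSuitableWeakSolutionInBall 1 0 v' π') (hlam : ∀ j, 0 < lam j)
    (hlam0 : Tendsto lam atTop (𝓝 0)) (hr₁ : 0 < r₁) (hr₁1 : r₁ ≤ 1)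
    (hKs : ∀ r ∈ Ioc (0 : ℝ) r₁, cknD r (0 : ℝ × EuclideanSpace ℝ (Fin 3)) π' ≤ Ks)
    (hpt : ∀ (j : ℕ) (s : ℝ) (y : EuclideanSpace ℝ (Fin 3)),
      ((lam j) • stPull ((lam j) ^ 2) (lam j) (0 : ℝ) (0 : EuclideanSpace ℝ (Fin 3)) v') s y =
        ((R * (lam j / 2)) / ν) • u (T + (R * (lam j / 2)) ^ 2 * s / ν) (x₀ + (R * (lam j / 2)) • y))
    (hr₀ : 0 < r₀) (hr₀x : r₀ ≤ ‖x‖ / 2) :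
    ∃ (J : ℕ) (K' : ℝ), 0 ≤ K' ∧ ∀ j, J ≤ j →
      ∀ w ∈ parabolicCylinder (r₀ / 2) (((0 : ℝ), x) : ℝ × EuclideanSpace ℝ (Fin 3)), ∃ D : EuclideanSpace ℝ (Fin 3),
        HasDerivAt (fun σ => curl ((((R * (lam j / 2)) / ν) • stPull ((R * (lam j / 2)) ^ 2 / ν) (R * (lam j / 2)) T x₀ u) σ)
          w.2) D w.1 ∧ ‖D‖ ≤ K' := by
  have hΛpos : ∀ j, 0 < (R * (lam j / 2)) := fun j => mul_pos hR (half_pos (hlam j))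
  have hΛ0 : Tendsto (fun j => (R * (lam j / 2))) atTop (𝓝 0) := by
    simpa using (hlam0.div_const 2).const_mul R
  obtain ⟨J₀, K, hK0, hK⟩ := zoom_top_uniform_bounds hν hT hsol hρ hM hR hball1 hlam hlam0 hr₁ hr₁1 hKs hpt hr₀ hr₀x
  -- the zoomed times of `]-a², 0[` lie in `[0,T)`
  set a : ℝ := 2 * ‖x‖ + 2 with ha_def
  have ha : 0 < a := by positivity
  obtain ⟨J₁, hJ₁⟩ := eventually_atTop.1 (eventually_zoom_region (x₀ := x₀) hν hT hρ hΛpos hΛ0 ha)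
  set κ : ℝ := ‖curlCLM‖ with hκ
  refine ⟨max J₀ J₁, 3 * 1 * κ * K + 2 * κ * K ^ 2, by positivity, fun j hj w hw => ?_⟩
  have hj₀ : J₀ ≤ j := (le_max_left _ _).trans hj
  have hj₁ : J₁ ≤ j := (le_max_right _ _).trans hj
  set μ : ℝ := R * (lam j / 2) with hμ
  have hμpos : 0 < μ := hΛpos j
  -- the zoom as a classical solution of the unit-viscosity system on `]-a², 0[`
  set Zu : ℝ → EuclideanSpace ℝ (Fin 3) → EuclideanSpace ℝ (Fin 3) :=
    (μ / ν) • stPull (μ ^ 2 / ν) μ T x₀ u with hZu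
  have hβ : μ ^ 2 / ν = μ / ν * μ := by ring
  have hcl := hsol.stRescale (α := μ / ν) (γ := μ) (β := μ ^ 2 / ν) (div_pos hμpos hν) hμpos hβ T x₀
  have hν1 : μ / ν * ν / μ = 1 := by field_simp
  have hf0 : ((μ / ν) ^ 2 * μ) • stPull (μ ^ 2 / ν) μ T x₀ (0 : ℝ → EuclideanSpace ℝ (Fin 3) → EuclideanSpace ℝ (Fin 3)) = 0 := by
    funext t y; simp [stPull_apply]
  rw [hν1, hf0] at hcl
  set S' : Set ℝ := Ioo (-a ^ 2) 0 with hS'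
  have hS'sub : S' ⊆ (fun r => T + μ ^ 2 / ν * r) ⁻¹' Ico 0 T := by
    intro σ hσ
    have hz : ((σ, (0 : EuclideanSpace ℝ (Fin 3))) : ℝ × EuclideanSpace ℝ (Fin 3)) ∈
        parabolicCylinder a (0 : ℝ × EuclideanSpace ℝ (Fin 3)) := by
      rw [SuitableCompactness.mem_parabolicCylinder_zero]; exact ⟨hσ, by simpa using ha⟩
    have h := (hJ₁ j hj₁ _ hz).1
    show T + μ ^ 2 / ν * σ ∈ Ico 0 T
    have e : T + μ ^ 2 / ν * σ = T + μ ^ 2 * σ / ν := by ring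
    rw [e]; exact h
  have hcl' := hcl.mono hS'sub isOpen_Ioo.uniqueDiffOn
  -- the point `(s, y)`
  obtain ⟨s, y⟩ := w
  rw [mem_parabolicCylinder_top_iff] at hw
  obtain ⟨⟨hs1, hs2⟩, hy⟩ := hw
  simp only at hs1 hs2 hy ⊢
  have hr2a : (r₀ / 2) ^ 2 < a ^ 2 := by
    have : r₀ / 2 < a := by rw [ha_def]; linarith [norm_nonneg x]
    nlinarith
  have hs : s ∈ S' := ⟨by linarith, hs2⟩
  -- `∂ₛ curl Zu = curl (∂ₛ Zu)` at interior times
  have hD : HasDerivAt (fun σ => fderiv ℝ (Zu σ) y) (fderiv ℝ (timeDerivWithin S' Zu s) y) s :=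
    hcl'.smooth_velocity.hasDerivAt_fderiv_slice_timeDerivWithin isOpen_Ioo subset_rfl hs y
  have hDc : HasDerivAt (fun σ => curl (Zu σ) y) (curl (timeDerivWithin S' Zu s) y) s := by
    have h := curlCLM.hasFDerivAt.comp_hasDerivAt s hD
    simpa [Function.comp_def, curl_eq_curlCLM] using h
  refine ⟨curl (timeDerivWithin S' Zu s) y, hDc, ?_⟩
  -- the vorticity equation and the pointwise bounds
  have heq := hcl'.curl_timeDerivWithin_eq isOpen_Ioo.uniqueDiffOn hs y
  rw [Pi.zero_apply, curl_zero, add_zero] at heq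
  have hV3 : ContDiffOn ℝ 3 (Zu s) univ := ((hcl'.contDiff_velocity hs).of_le (by norm_cast)).contDiffOn
  -- `Zu = Zⱼ` as functions, so the uniform bounds of `zoom_top_uniform_bounds` apply
  have hZeq : ((lam j) • stPull ((lam j) ^ 2) (lam j) (0 : ℝ) (0 : EuclideanSpace ℝ (Fin 3)) v') = Zu := by
    funext σ y'
    rw [hpt j σ y', hZu, smul_stPull_apply]
    congr 2
    ring
  have hwmem : ((s, y) : ℝ × EuclideanSpace ℝ (Fin 3)) ∈
      parabolicCylinder (r₀ / 2) (((0 : ℝ), x) : ℝ × EuclideanSpace ℝ (Fin 3)) := by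
    rw [mem_parabolicCylinder_top_iff]; exact ⟨⟨hs1, hs2⟩, hy⟩
  have hb : ∀ n ≤ 3, ‖iteratedFDeriv ℝ n (Zu s) y‖ ≤ K := by
    intro n hn
    have h := hK j hj₀ (s, y) hwmem n hn
    rwa [hZeq] at h
  have h0 : ‖Zu s y‖ ≤ K := by rw [← norm_iteratedFDeriv_zero (𝕜 := ℝ)]; exact hb 0 (by norm_num)
  have h1 : ‖fderiv ℝ (Zu s) y‖ ≤ K := by
    rw [← norm_iteratedFDeriv_zero (𝕜 := ℝ) (f := fderiv ℝ (Zu s)), norm_iteratedFDeriv_fderiv]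
    exact hb 1 (by norm_num)
  have hvb := (vorticity_pointwise_bounds isOpen_univ hV3 (mem_univ y) hK0 zero_le_one h0 h1 (hb 2 (by norm_num))
    (hb 3 (by norm_num))).2.2.2
  rw [heq]
  exact hvb

end Summit.NavierStokesRegularity.NavierStokesRegularity.Theorems.LocalIrrotationalScarDoorZoomTopRegularity

end
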